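import Summits.SmoothPoincare4.SmoothPoincare4.Theorems.SullivanDualHyperbolicEndStubModelFoliationDataHalf
import Literature.Geometry.Symplectic.NearSymplecticFlatBirthDesign

/-!
# Route `SullivanDual`, crux `HyperbolicEnd` (stmt-SmoothPoincare4-7825), line `taubes-circle-pencil`:
# the DATA HALF of stub SM `stub_modelFoliation`, now UNCONDITIONAL

The staging theorem `helper_flatNearSymplecticData_of_flatNearSymplecticTaubesTubes`
(`Theorems/SullivanDualHyperbolicEndStubModelFoliationDataHalf.lean`, p159197) closed the first
conjunct of stub SM of the checked skeleton `Cruxes/HyperbolicEnd/Lines/taubes_circle_pencil.lean`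
modulo the Literature named fact `Literature.Geometry.Symplectic.flatNearSymplecticTaubesTubes_exists`
(Perutz 2006 Prop. 1.5 / Rem. 1.9 + Honda 2004 Thm. 5 = Taubes 1998 §1.c).  That fact has since been
DISCHARGED in the tree (`flatNearSymplecticTaubesTubes_exists_holds`,
`Literature/Geometry/Symplectic/NearSymplecticFlatBirthDesign.lean`: the explicit Calabi–Perutz birth
pair with rational charts).  This file records the composition as the registered helper
`helper_flatNearSymplecticData_exists`: flat near-symplectic data on `ℝ⁴`, standard at infinity, with
two flat untwisted Taubes tubes — the first conjunct of `stub_modelFoliation` verbatim — EXIST,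
unconditionally and kernel-checked.  The other three conjuncts of SM (pinned `J`, transparent planar
`J`-foliation off `Z₀`, leafwise finite energy) are untouched; their status is the subject of the
line's memos `Cruxes/HyperbolicEnd/Lines/taubes-circle-pencil-*.md`.
-/

-- the registered namespace `Summit.SmoothPoincare4.SmoothPoincare4.…` repeats a component (P = Sub)
set_option linter.dupNamespace false

noncomputable section

open Literature.Geometry.Symplectic

namespace Summit.SmoothPoincare4.SmoothPoincare4.Cruxes.HyperbolicEnd.TaubesCirclePencil

-- registered signature, verbatim on one line (gate matches name + header textually)
/-- **The data half of stub SM, unconditionally.**  There are `R`, `0 < δ < 1`, a smooth closed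
`2`-form `sf₀` on `ℝ⁴` equal to `ω₀` on `{R ≤ ‖y‖}`, and two flat Taubes tubes `Ψ₁, Ψ₂` of `sf₀` of
radius `δ` inside `B_R` with disjoint images, `sf₀` non-degenerate off the tube images:
`IsFlatNearSymplecticData R δ sf₀ Ψ₁ Ψ₂` — the first conjunct of `stub_modelFoliation`.  Proof: the
staging helper applied to the discharged Literature fact (Perutz 2006 Prop. 1.5 / Rem. 1.9, Honda 2004
Thm. 5, Taubes 1998 §1.c, as formalised in `NearSymplecticFlatBirthDesign.lean`). [folklore] -/
theorem helper_flatNearSymplecticData_exists : ∃ (R δ : ℝ) (sf₀ : EuclideanSpace ℝ (Fin 4) → EuclideanSpace ℝ (Fin 4) [⋀^Fin 2]→L[ℝ] ℝ) (Ψ₁ Ψ₂ : EuclideanSpace ℝ (Fin 4) → EuclideanSpace ℝ (Fin 4)), IsFlatNearSymplecticData R δ sf₀ Ψ₁ Ψ₂ :=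
  helper_flatNearSymplecticData_of_flatNearSymplecticTaubesTubes flatNearSymplecticTaubesTubes_exists_holds

end Summit.SmoothPoincare4.SmoothPoincare4.Cruxes.HyperbolicEnd.TaubesCirclePencil

end
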